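import Mathlib
import Literature.Algebra.Polynomial.GramMatrixMethod
import HarnessLib

/-!
# Perturbation and absorption: exact weighted SOS from a numerical SOS with remainder

Topic `Algebra/Polynomial`; namespace `Literature.Algebra.Polynomial.SosPerturbationAbsorption`.
Everything below is PROVED (no named fact, no `sorry`, no definition, no instance, no notation);
the private plumbing lemmas are marked [folklore].

SOURCE (read from the fetched text of the paper, `paper:arxiv-1802.10339`, §3 "Exact SOS
representations" = §3 of the ISSAC version): V. Magron, M. Safey El Din, *On exact Polya and
Putinar's representations*, Proc. ISSAC 2018, 279–286 [MagronSafeyeldin2018].  Their hybrid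
numeric–symbolic algorithm `intsos` certifies that a polynomial `f` in the interior of the SOS cone
is a sum of squares with RATIONAL data, in three steps (`P/2` = the halved Newton polytope, a finite
set `S` of exponents; `t := Σ_{α ∈ S} X^{2α}`; `r := #S`):

1. PERTURB [Prop. 3.1 and its proof]: "there exists `N ∈ ℕ − {0}` such that for `ε := 1/2^N`,
   `f − ε Σ_{α ∈ P/2} X^{2α} ∈ Σ̊[X]`", proved by the Gram identity
   "`f_ε := f − ε Σ_{α ∈ P/2} X^{2α} = v_kᵀ G v_k − ε v_kᵀ I v_k = v_kᵀ (G − ε I) v_k`" for a Gram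
   matrix `G ≻ 0` of `f` whose least eigenvalue exceeds `ε` — here `gramPoly_sub_smul_one`,
   `gramPoly_monomialVec_sub_smul_one` (the identity, over any commutative ring) and
   `isSumSq_sub_perturbation_of_posSemidef` (over `ℝ`: `G − εI ⪰ 0 ⇒ f_ε` is a sum of squares,
   through `GramMatrixMethod.isSumSq_gramPoly_of_posSemidef`).
2. NUMERICAL SOS WITH REMAINDER [§3.1]: an SDP solver and an approximate Cholesky factorisation
   return `s₁, …, s_r ∈ ℚ[X]`, and "we have to consider the remainder
   `u = f − ε Σ_{α ∈ P/2} X^{2α} − Σᵢ sᵢ²`".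
3. ABSORB [§3.1, subroutine `absorb` (lines 4–5 of its listing) and the displayed identities]:
   "The loop from `absorb` is designed to obtain an exact weighted SOS decomposition of
   `ε t + u = ε Σ_{α ∈ P/2} X^{2α} + Σ_γ u_γ X^γ` … Each term `u_γ X^γ` can be written either
   `u_γ X^{2α}` or `u_γ X^{α+β}`, for `α, β ∈ P/2`.  In the former case, one has
   `ε X^{2α} + u_γ X^{2α} = (ε + u_γ) X^{2α}`.  In the latter case, one has
   `ε (X^{2α} + X^{2β}) + u_γ X^{α+β} = |u_γ|/2 (X^α + sgn(u_γ) X^β)²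
   + (ε − |u_γ|/2)(X^{2α} + X^{2β})`."
   The algorithm keeps one budget `ε_α` per `α ∈ P/2` (initially `ε`), ADDS `u_γ` to `ε_{γ/2}` in
   the former case, SUBTRACTS `|u_γ|/2` from `ε_α` and from `ε_β` in the latter, and accepts iff
   "`min_{α ∈ P/2} {ε_α} ≥ 0`" (line 12 of `intsos`), appending the weights `ε_α` with the squares
   `(X^α)²` to the output lists.  [Proof of Prop. 3.4]: "This condition is fulfilled when for all
   `α ∈ P/2`, `ε − Σ_{β ∈ P/2} |u_{α+β}|/2 + u_α ≥ 0`.  This latter condition holds when for all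
   `γ ∈ spt(u)`, `|u_γ| ≤ ε/r`."

What is typed here, over any linearly ordered field `K` (`S` is any finite exponent set, not only
a halved Newton polytope; the ROUTING `γ = a γ + b γ`, `a γ, b γ ∈ S`, of each remainder exponent is
a parameter — `intsos` takes `a γ = b γ = γ/2` for even `γ` and some splitting otherwise):

* `absorb_identity_even`, `absorb_identity` — the two displayed identities (the second for every
  coefficient `c`, with Mathlib's `SignType.sign`; for `c = 0` both sides are
  `ε (X^{2α} + X^{2β})`).
* `perturbation_add_eq_weighted_sos` — **what `absorb` outputs**: the exact identity
  `Σ_{α ∈ S} ε_α X^{2α} + u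
  = Σ_{α ∈ S} ε'_α (X^α)² + Σ_{γ ∈ spt u, aγ ≠ bγ} |u_γ|/2 (X^{aγ} + sgn(u_γ) X^{bγ})²`
  with the FINAL budgets `ε'_α = ε_α − (debits routed to α)` written as filtered sums (a term with
  `a γ = b γ = α` debits `−u_γ`, i.e. credits `u_γ`; a term with `a γ ≠ b γ` debits `|u_γ|/2` at
  `a γ` and at `b γ`).
* `isSumSq_perturbation_add_of_budget` — **the acceptance test is sound**: if every final budget is
  `≥ 0` then `Σ ε_α X^{2α} + u` is a sum of squares in `K[X]`, for any `K` whose nonnegative scalars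
  are sums of squares (hypothesis `hK`; `ℝ`: `isSumSq_perturbation_add_of_budget_real`; for `ℚ`
  discharge `hK` with `OrderedFieldGramSos.isSumSq_rat_iff_nonneg`, Lagrange's four squares).
* `isSumSq_perturbation_add_of_abs_budget` (the symmetric test debiting `|u_γ|/2` at both ends,
  which the signed test refines), `isSumSq_perturbation_add_of_coeff_le` ("`|u_γ| ≤ ε/r` for all
  `γ ∈ spt(u)`" suffices, given `spt u ⊆ S + S`), `isSumSq_perturbation_add_of_sum_abs_le` (so does
  the routing-free `ℓ¹` test `Σ_γ |u_γ| ≤ ε`).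
* `isSumSq_of_remainder_coeff_le`, `isSumSq_of_remainder_sum_abs_le` (+ `_real`) — **end to end**
  [Prop. 3.4: `intsos` "outputs a weighted rational SOS decomposition of `f`"]: `f = ε t + v + u`
  with `v` a sum of squares (the numerical part `Σᵢ sᵢ²`) and a small remainder `u` supported in
  `S + S` ⇒ `f` is a sum of squares.

NOT typed: the bit-size bounds `τ d^{O(n)}` of Prop. 3.1/3.3/3.4 (quantifier elimination over the
reals), the Cholesky rounding analysis (Prop. 3.2) and the termination of the precision-doubling
loop.

Why the engines lane types this (shared numerical engines serving client cells; rigour lives in the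
verifiers): it is the a-priori form of "round, then repair the residual on the diagonal", the
alternative to the Peyrl–Parrilo projection (`Literature.Algebra.Polynomial.RationalSosRounding`,
`RationalSosCertificate`): a verifier handed the budgets `ε_α`, the `sᵢ` and the remainder `u`
replays `perturbation_add_eq_weighted_sos` and checks signs, nothing else.

## References

* [MagronSafeyeldin2018] V. Magron, M. Safey El Din, *On exact Polya and Putinar's
  representations*, Proc. ISSAC 2018 (ACM), 279–286, §3: Prop. 3.1, algorithm `intsos` with its
  subroutine `absorb`, Prop. 3.4; arXiv:1802.10339.
* [MagronSafeyeldinSchweighofer2019] V. Magron, M. Safey El Din, M. Schweighofer, *Algorithms for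
  weighted sum of squares decomposition of non-negative univariate polynomials*, J. Symb. Comput. 93
  (2019) 200–220 (the univariate `univsos2`, whose symbolic step `absorb` generalises — §3.1).
* [PeyrlParrilo2008] H. Peyrl, P. A. Parrilo, Theoret. Comput. Sci. 409 (2008) 269–281 (the
  projection alternative).
-/

open MvPolynomial Finset

open scoped BigOperators Pointwise

namespace Literature.Algebra.Polynomial.SosPerturbationAbsorption

open Literature.Algebra.Polynomial.GramMatrixMethod

universe u v w

variable {K : Type u} [Field K] [LinearOrder K] [IsStrictOrderedRing K]
variable {σ : Type v}

/-! ### §0. Plumbing -/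

/-- The image of a sum of squares under a ring homomorphism is a sum of squares. [folklore] -/
private theorem isSumSq_map {R R' : Type*} [CommSemiring R] [CommSemiring R'] (f : R →+* R')
    {a : R} (ha : IsSumSq a) : IsSumSq (f a) := by
  induction ha with
  | zero => rw [map_zero]; exact IsSumSq.zero
  | sq_add a _ ih => simpa [map_add, map_mul] using IsSumSq.sq_add (f a) ih

omit [LinearOrder K] [IsStrictOrderedRing K] in
/-- `c · p²` is a sum of squares of polynomials when the scalar `c` is a sum of squares.
[folklore] -/
private theorem isSumSq_C_mul_sq {c : K} (hc : IsSumSq c) (p : MvPolynomial σ K) :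
    IsSumSq (C c * p ^ 2) := by
  rw [pow_two]
  exact IsSumSq.mul (isSumSq_map C hc) (IsSumSq.mul_self p)

omit [LinearOrder K] [IsStrictOrderedRing K] in
/-- `X^{2α} = (X^α)²`. [folklore] -/
private theorem monomial_two_nsmul (α : σ →₀ ℕ) :
    (monomial (2 • α) (1 : K) : MvPolynomial σ K) = monomial α 1 ^ 2 := by
  rw [pow_two, monomial_mul, mul_one, two_nsmul]

/-- Nonnegative reals are squares. [folklore] -/
private theorem real_isSumSq_of_nonneg {c : ℝ} (hc : 0 ≤ c) : IsSumSq c := by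
  rw [← Real.mul_self_sqrt hc]
  exact IsSumSq.mul_self _

omit [IsStrictOrderedRing K] in
/-- `sgn(c)² = 1` for `c ≠ 0`. [folklore] -/
private theorem sign_mul_sign_eq_one {c : K} (hc : c ≠ 0) :
    (SignType.sign c : K) * (SignType.sign c : K) = 1 := by
  rcases hc.lt_or_gt with h | h
  · rw [sign_neg h]; simp
  · rw [sign_pos h]; simp

/-- The odd-case identity for arbitrary factors `x, y` in place of `X^α, X^β`:
`c·xy = |c|/2 · (x + sgn(c) y)² − |c|/2 · (x² + y²)` (`c ≠ 0`). [folklore] -/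
private theorem absorb_core {c : K} (hc : c ≠ 0) (x y : MvPolynomial σ K) :
    C c * (x * y) = C (|c| / 2) * (x + C (SignType.sign c : K) * y) ^ 2
      - (C (|c| / 2) * (x * x) + C (|c| / 2) * (y * y)) := by
  have H1 : C (SignType.sign c : K) * C (SignType.sign c : K) = (1 : MvPolynomial σ K) := by
    rw [← map_mul, sign_mul_sign_eq_one hc, map_one]
  have H2 : C |c| * C (SignType.sign c : K) = (C c : MvPolynomial σ K) := by
    rw [← map_mul, abs_mul_sign]
  have H3 : C (|c| / 2) * 2 = (C |c| : MvPolynomial σ K) := by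
    rw [← map_ofNat C 2, ← map_mul, div_mul_cancel₀ _ (two_ne_zero : (2 : K) ≠ 0)]
  linear_combination (-(C (|c| / 2) * (y * y))) * H1 + (-(x * y)) * H2
    + (-(x * y) * C (SignType.sign c : K)) * H3

/-! ### §1. The two absorption identities [MagronSafeyeldin2018, §3.1] -/

omit [LinearOrder K] [IsStrictOrderedRing K] in
/-- **Even case** of `absorb` (line 4 of its listing):
"`ε X^{2α} + u_γ X^{2α} = (ε + u_γ) X^{2α}`" — the coefficient of an even remainder term is simply
added to the budget of `α = γ/2`.
[cite: MagronSafeyeldin2018, §3.1 (algorithm absorb, line 4)] -/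
theorem absorb_identity_even (ε c : K) (α : σ →₀ ℕ) :
    C ε * monomial (2 • α) (1 : K) + monomial (2 • α) c = C (ε + c) * monomial (2 • α) 1 := by
  simp only [map_add, add_mul, C_mul_monomial, mul_one]

/-- **Odd case** of `absorb` (line 5 of its listing), the displayed identity
"`ε (X^{2α} + X^{2β}) + u_γ X^{α+β}
= |u_γ|/2 (X^α + sgn(u_γ) X^β)² + (ε − |u_γ|/2)(X^{2α} + X^{2β})`":
a mixed remainder term is absorbed by one weighted binomial square at the price `|u_γ|/2` on each
of the two budgets.  (Stated for every `c = u_γ`; for `c = 0`, where `sgn 0 = 0`, both sides equal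
`ε (X^{2α} + X^{2β})`.)
[cite: MagronSafeyeldin2018, §3.1 (displayed identity after algorithm absorb)] -/
theorem absorb_identity (ε c : K) (α β : σ →₀ ℕ) :
    C ε * (monomial (2 • α) (1 : K) + monomial (2 • β) 1) + monomial (α + β) c =
      C (|c| / 2) * (monomial α 1 + C (SignType.sign c : K) * monomial β 1) ^ 2 +
        C (ε - |c| / 2) * (monomial (2 • α) 1 + monomial (2 • β) 1) := by
  rcases eq_or_ne c 0 with rfl | hc
  · simp
  · have hm : (monomial (α + β) c : MvPolynomial σ K) =
        C c * (monomial α 1 * monomial β 1) := by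
      rw [monomial_mul, mul_one, C_mul_monomial, mul_one]
    rw [hm, absorb_core hc, two_nsmul, two_nsmul, monomial_mul, monomial_mul, mul_one, map_sub]
    ring

/-! ### §2. What `absorb` outputs: the exact weighted SOS identity -/

omit [LinearOrder K] [IsStrictOrderedRing K] in
/-- Regrouping the diagonal debits by the exponent of `S` they are routed to. [folklore] -/
private theorem sum_debit_eq [DecidableEq σ] (S T : Finset (σ →₀ ℕ)) (a : (σ →₀ ℕ) → σ →₀ ℕ)
    (ha : ∀ γ ∈ T, a γ ∈ S) (d : (σ →₀ ℕ) → K) :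
    ∑ γ ∈ T, C (d γ) * monomial (2 • a γ) (1 : K) =
      ∑ α ∈ S, C (∑ γ ∈ T with a γ = α, d γ) * monomial (2 • α) 1 := by
  rw [← Finset.sum_fiberwise_of_maps_to ha]
  refine Finset.sum_congr rfl fun α _ => ?_
  rw [map_sum, Finset.sum_mul]
  refine Finset.sum_congr rfl fun γ hγ => ?_
  rw [(Finset.mem_filter.mp hγ).2]

/-- One remainder term rewritten along its routing `γ = a γ + b γ`: a weighted square minus the
debits (even case: no square, the signed coefficient goes to the diagonal). [folklore] -/
private theorem term_eq [DecidableEq σ] (u : MvPolynomial σ K) (a b : (σ →₀ ℕ) → σ →₀ ℕ)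
    {γ : σ →₀ ℕ} (hab : a γ + b γ = γ) (hc : u.coeff γ ≠ 0) :
    (monomial γ (u.coeff γ) : MvPolynomial σ K) =
      C (if a γ = b γ then 0 else |u.coeff γ| / 2) *
          (monomial (a γ) 1 + C (SignType.sign (u.coeff γ) : K) * monomial (b γ) 1) ^ 2 -
        (C (if a γ = b γ then -u.coeff γ else |u.coeff γ| / 2) * monomial (2 • a γ) 1 +
          C (if a γ = b γ then 0 else |u.coeff γ| / 2) * monomial (2 • b γ) 1) := by
  by_cases h : a γ = b γ
  · have hγ : 2 • b γ = γ :=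
      calc 2 • b γ = b γ + b γ := two_nsmul _
        _ = a γ + b γ := by rw [h]
        _ = γ := hab
    simp only [h, if_true, hγ, map_zero, zero_mul, zero_sub, add_zero, map_neg, neg_mul, neg_neg,
      C_mul_monomial, mul_one]
  · have hm : (monomial γ (u.coeff γ) : MvPolynomial σ K) =
        C (u.coeff γ) * (monomial (a γ) 1 * monomial (b γ) 1) := by
      rw [monomial_mul, mul_one, hab, C_mul_monomial, mul_one]
    rw [if_neg h, if_neg h, hm, absorb_core hc, two_nsmul, two_nsmul, monomial_mul, monomial_mul,
      mul_one]

/-- **What `absorb` outputs — the exact weighted SOS identity.**  For budgets `ε_α` (`α ∈ S`) and a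
remainder `u` each of whose exponents is routed as `γ = a γ + b γ` with `a γ, b γ ∈ S`:
`Σ_{α ∈ S} ε_α X^{2α} + u
= Σ_{α ∈ S} ε'_α · X^{2α} + Σ_{γ ∈ spt u} w_γ · (X^{aγ} + sgn(u_γ) X^{bγ})²`,
where `w_γ = |u_γ|/2` if `a γ ≠ b γ` and `0` otherwise, and the FINAL BUDGET `ε'_α` is `ε_α` minus
the debits routed to `α`: `−u_γ` for each `γ` with `a γ = b γ = α` (line 4 of `absorb`:
`ε_α := ε_α + u_γ`), `|u_γ|/2` for each `γ` with `a γ ≠ b γ` and `a γ = α`, resp. `b γ = α` (line 5: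
`ε_α := ε_α − |u_γ|/2, ε_β := ε_β − |u_γ|/2`).  These are exactly the lists `c_list, s_list`
(`ε_α ↔ X^α`, `|u_γ|/2 ↔ X^α + sgn(u_γ) X^β`) appended by `intsos`/`absorb`.
[cite: MagronSafeyeldin2018, §3.1 (algorithms intsos lines 11–14, absorb lines 2–5)] -/
theorem perturbation_add_eq_weighted_sos [DecidableEq σ] (S : Finset (σ →₀ ℕ))
    (ε : (σ →₀ ℕ) → K) (u : MvPolynomial σ K) (a b : (σ →₀ ℕ) → σ →₀ ℕ)
    (ha : ∀ γ ∈ u.support, a γ ∈ S) (hb : ∀ γ ∈ u.support, b γ ∈ S)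
    (hab : ∀ γ ∈ u.support, a γ + b γ = γ) :
    (∑ α ∈ S, C (ε α) * monomial (2 • α) (1 : K)) + u =
      (∑ α ∈ S, C (ε α
          - (∑ γ ∈ u.support with a γ = α, if a γ = b γ then -u.coeff γ else |u.coeff γ| / 2)
          - (∑ γ ∈ u.support with b γ = α, if a γ = b γ then 0 else |u.coeff γ| / 2)) *
          monomial (2 • α) 1) +
        ∑ γ ∈ u.support, C (if a γ = b γ then 0 else |u.coeff γ| / 2) *
          (monomial (a γ) 1 + C (SignType.sign (u.coeff γ) : K) * monomial (b γ) 1) ^ 2 := by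
  have hu : u = ∑ γ ∈ u.support, (C (if a γ = b γ then 0 else |u.coeff γ| / 2) *
      (monomial (a γ) 1 + C (SignType.sign (u.coeff γ) : K) * monomial (b γ) 1) ^ 2 -
      (C (if a γ = b γ then -u.coeff γ else |u.coeff γ| / 2) * monomial (2 • a γ) 1 +
        C (if a γ = b γ then 0 else |u.coeff γ| / 2) * monomial (2 • b γ) 1)) := by
    conv_lhs => rw [u.as_sum]
    exact Finset.sum_congr rfl fun γ hγ => term_eq u a b (hab γ hγ) (mem_support_iff.mp hγ)
  conv_lhs => rw [hu]
  rw [Finset.sum_sub_distrib, Finset.sum_add_distrib, sum_debit_eq S _ a ha, sum_debit_eq S _ b hb]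
  simp only [map_sub, sub_mul, Finset.sum_sub_distrib]
  ring

/-! ### §3. The acceptance test of `intsos` is sound -/

/-- **Soundness of the test `min_α ε_α ≥ 0`** (line 12 of `intsos`): if every final budget is
nonnegative — for each `α ∈ S`, the debits routed to `α` do not exceed `ε_α` — then
`Σ_{α ∈ S} ε_α X^{2α} + u` is a sum of squares of polynomials over `K`.  Here `K` is any linearly
ordered field whose nonnegative elements are sums of squares (`hK`): `ℝ` (`…_real` below), `ℚ`
(Lagrange; `OrderedFieldGramSos.isSumSq_rat_iff_nonneg`), real closed fields.
[cite: MagronSafeyeldin2018, §3.1 (algorithm intsos line 12) and proof of Prop. 3.4] -/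
theorem isSumSq_perturbation_add_of_budget [DecidableEq σ] (hK : ∀ c : K, 0 ≤ c → IsSumSq c)
    (S : Finset (σ →₀ ℕ)) (ε : (σ →₀ ℕ) → K) (u : MvPolynomial σ K) (a b : (σ →₀ ℕ) → σ →₀ ℕ)
    (ha : ∀ γ ∈ u.support, a γ ∈ S) (hb : ∀ γ ∈ u.support, b γ ∈ S)
    (hab : ∀ γ ∈ u.support, a γ + b γ = γ)
    (hε : ∀ α ∈ S,
      (∑ γ ∈ u.support with a γ = α, if a γ = b γ then -u.coeff γ else |u.coeff γ| / 2) +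
        (∑ γ ∈ u.support with b γ = α, if a γ = b γ then 0 else |u.coeff γ| / 2) ≤ ε α) :
    IsSumSq ((∑ α ∈ S, C (ε α) * monomial (2 • α) (1 : K)) + u) := by
  rw [perturbation_add_eq_weighted_sos S ε u a b ha hb hab]
  refine IsSumSq.add (IsSumSq.sum fun α hα => ?_) (IsSumSq.sum fun γ _ => ?_)
  · rw [monomial_two_nsmul]
    exact isSumSq_C_mul_sq (hK _ (by linarith [hε α hα])) _
  · refine isSumSq_C_mul_sq (hK _ ?_) _
    split_ifs
    · exact le_rfl
    · positivity

/-- Over `ℝ`: the budget test certifies a sum of squares in `ℝ[X]`.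
[cite: MagronSafeyeldin2018, §3.1 (algorithm intsos line 12) and proof of Prop. 3.4] -/
theorem isSumSq_perturbation_add_of_budget_real [DecidableEq σ] (S : Finset (σ →₀ ℕ))
    (ε : (σ →₀ ℕ) → ℝ) (u : MvPolynomial σ ℝ) (a b : (σ →₀ ℕ) → σ →₀ ℕ)
    (ha : ∀ γ ∈ u.support, a γ ∈ S) (hb : ∀ γ ∈ u.support, b γ ∈ S)
    (hab : ∀ γ ∈ u.support, a γ + b γ = γ)
    (hε : ∀ α ∈ S,
      (∑ γ ∈ u.support with a γ = α, if a γ = b γ then -u.coeff γ else |u.coeff γ| / 2) +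
        (∑ γ ∈ u.support with b γ = α, if a γ = b γ then 0 else |u.coeff γ| / 2) ≤ ε α) :
    IsSumSq ((∑ α ∈ S, C (ε α) * monomial (2 • α) (1 : ℝ)) + u) :=
  isSumSq_perturbation_add_of_budget (fun _ h => real_isSumSq_of_nonneg h) S ε u a b ha hb hab hε

/-- **The symmetric test** (debit `|u_γ|/2` at `a γ` and at `b γ` for EVERY term, also the even
ones) is sound as well — the signed test above refines it, since `−u_γ ≤ |u_γ|`.
[cite: MagronSafeyeldin2018, proof of Prop. 3.4 ("ε − Σ_β |u_{α+β}|/2 … ≥ 0")] -/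
theorem isSumSq_perturbation_add_of_abs_budget [DecidableEq σ] (hK : ∀ c : K, 0 ≤ c → IsSumSq c)
    (S : Finset (σ →₀ ℕ)) (ε : (σ →₀ ℕ) → K) (u : MvPolynomial σ K) (a b : (σ →₀ ℕ) → σ →₀ ℕ)
    (ha : ∀ γ ∈ u.support, a γ ∈ S) (hb : ∀ γ ∈ u.support, b γ ∈ S)
    (hab : ∀ γ ∈ u.support, a γ + b γ = γ)
    (hε : ∀ α ∈ S, (∑ γ ∈ u.support with a γ = α, |u.coeff γ| / 2) +
      (∑ γ ∈ u.support with b γ = α, |u.coeff γ| / 2) ≤ ε α) :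
    IsSumSq ((∑ α ∈ S, C (ε α) * monomial (2 • α) (1 : K)) + u) := by
  refine isSumSq_perturbation_add_of_budget hK S ε u a b ha hb hab fun α hα => ?_
  refine le_trans ?_ (hε α hα)
  rw [Finset.sum_filter, Finset.sum_filter, Finset.sum_filter, Finset.sum_filter,
    ← Finset.sum_add_distrib, ← Finset.sum_add_distrib]
  refine Finset.sum_le_sum fun γ _ => ?_
  rcases eq_or_ne (a γ) (b γ) with h | h
  · simp only [h, if_true, ite_self, add_zero]
    split_ifs <;> linarith [neg_le_abs (u.coeff γ), abs_nonneg (u.coeff γ)]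
  · simp [h]

/-- A fibre of the routing has at most `#S` elements: on `{γ : a γ = α}` the map `γ ↦ b γ ∈ S` is
injective, because `γ = a γ + b γ`. [folklore] -/
private theorem card_fiber_le [DecidableEq σ] (S T : Finset (σ →₀ ℕ)) (a b : (σ →₀ ℕ) → σ →₀ ℕ)
    (hb : ∀ γ ∈ T, b γ ∈ S) (hab : ∀ γ ∈ T, a γ + b γ = γ) (α : σ →₀ ℕ) :
    (T.filter fun γ => a γ = α).card ≤ S.card := by
  refine Finset.card_le_card_of_injOn b (fun γ hγ => hb γ (Finset.mem_filter.mp hγ).1) ?_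
  intro γ₁ hγ₁ γ₂ hγ₂ h
  obtain ⟨h₁, e₁⟩ := Finset.mem_filter.mp hγ₁
  obtain ⟨h₂, e₂⟩ := Finset.mem_filter.mp hγ₂
  rw [← hab γ₁ h₁, ← hab γ₂ h₂, e₁, e₂, h]

/-- Hence a coefficient bound `|u_γ| ≤ ε/#S` bounds the debits on each fibre by `ε/2`. [folklore] -/
private theorem sum_fiber_le [DecidableEq σ] (S T : Finset (σ →₀ ℕ)) (a b : (σ →₀ ℕ) → σ →₀ ℕ)
    (hb : ∀ γ ∈ T, b γ ∈ S) (hab : ∀ γ ∈ T, a γ + b γ = γ) {ε : K} (hε : 0 ≤ ε)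
    (u : MvPolynomial σ K) (hcoeff : ∀ γ ∈ T, |u.coeff γ| ≤ ε / S.card) {α : σ →₀ ℕ}
    (hα : α ∈ S) : ∑ γ ∈ T with a γ = α, |u.coeff γ| / 2 ≤ ε / 2 := by
  have hS : (0 : K) < S.card := by exact_mod_cast Finset.card_pos.mpr ⟨α, hα⟩
  calc ∑ γ ∈ T with a γ = α, |u.coeff γ| / 2
      ≤ ∑ γ ∈ T with a γ = α, ε / S.card / 2 :=
        Finset.sum_le_sum fun γ hγ => by
          have := hcoeff γ (Finset.mem_filter.mp hγ).1
          linarith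
    _ = (T.filter fun γ => a γ = α).card * (ε / S.card / 2) := by
        rw [Finset.sum_const, nsmul_eq_mul]
    _ ≤ S.card * (ε / S.card / 2) :=
        mul_le_mul_of_nonneg_right (by exact_mod_cast card_fiber_le S T a b hb hab α)
          (div_nonneg (div_nonneg hε hS.le) zero_le_two)
    _ = ε / 2 := by
        field_simp

/-- **"This latter condition holds when for all `γ ∈ spt(u)`, `|u_γ| ≤ ε/r`"** (`r = #S`): a
remainder supported in `S + S` with all coefficients at most `ε/#S` in absolute value is absorbed:
`ε Σ_{α ∈ S} X^{2α} + u` is a sum of squares.  (Each fibre of a routing has at most `#S` terms, so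
the symmetric test passes with every final budget `≥ ε − 2 · #S · (ε/#S)/2 = 0`.)
[cite: MagronSafeyeldin2018, proof of Prop. 3.4] -/
theorem isSumSq_perturbation_add_of_coeff_le [DecidableEq σ] (hK : ∀ c : K, 0 ≤ c → IsSumSq c)
    (S : Finset (σ →₀ ℕ)) {ε : K} (hε : 0 ≤ ε) (u : MvPolynomial σ K) (hsupp : u.support ⊆ S + S)
    (hcoeff : ∀ γ ∈ u.support, |u.coeff γ| ≤ ε / S.card) :
    IsSumSq (C ε * (∑ α ∈ S, monomial (2 • α) (1 : K)) + u) := by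
  choose! a ha b hb hab using fun γ (hγ : γ ∈ u.support) => Finset.mem_add.mp (hsupp hγ)
  rw [Finset.mul_sum]
  refine isSumSq_perturbation_add_of_abs_budget hK S (fun _ => ε) u a b ha hb hab fun α hα => ?_
  have hA := sum_fiber_le S u.support a b hb hab hε u hcoeff hα
  have hB := sum_fiber_le S u.support b a ha (fun γ hγ => by rw [add_comm]; exact hab γ hγ) hε u
    hcoeff hα
  linarith

/-- **The routing-free `ℓ¹` test**: a remainder supported in `S + S` with `Σ_γ |u_γ| ≤ ε` is
absorbed: `ε Σ_{α ∈ S} X^{2α} + u` is a sum of squares (every debit on a budget is at most the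
term's `|u_γ|`, so each final budget is `≥ ε − Σ_γ |u_γ|`).
[cite: MagronSafeyeldin2018, proof of Prop. 3.4] -/
theorem isSumSq_perturbation_add_of_sum_abs_le [DecidableEq σ] (hK : ∀ c : K, 0 ≤ c → IsSumSq c)
    (S : Finset (σ →₀ ℕ)) {ε : K} (u : MvPolynomial σ K) (hsupp : u.support ⊆ S + S)
    (hsum : ∑ γ ∈ u.support, |u.coeff γ| ≤ ε) :
    IsSumSq (C ε * (∑ α ∈ S, monomial (2 • α) (1 : K)) + u) := by
  choose! a ha b hb hab using fun γ (hγ : γ ∈ u.support) => Finset.mem_add.mp (hsupp hγ)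
  rw [Finset.mul_sum]
  refine isSumSq_perturbation_add_of_abs_budget hK S (fun _ => ε) u a b ha hb hab fun α hα => ?_
  have h0 : ∀ γ ∈ u.support, γ ∉ u.support.filter (fun γ => a γ = α) → 0 ≤ |u.coeff γ| / 2 :=
    fun γ _ _ => by positivity
  have h0' : ∀ γ ∈ u.support, γ ∉ u.support.filter (fun γ => b γ = α) → 0 ≤ |u.coeff γ| / 2 :=
    fun γ _ _ => by positivity
  have hA := Finset.sum_le_sum_of_subset_of_nonneg (Finset.filter_subset (fun γ => a γ = α) _) h0
  have hB := Finset.sum_le_sum_of_subset_of_nonneg (Finset.filter_subset (fun γ => b γ = α) _) h0'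
  have h2 : ∑ γ ∈ u.support, |u.coeff γ| / 2 = (∑ γ ∈ u.support, |u.coeff γ|) / 2 := by
    rw [Finset.sum_div]
  linarith

/-! ### §4. End to end: numerical SOS plus absorbed remainder [MagronSafeyeldin2018, Prop. 3.4] -/

/-- **`intsos` outputs a sum of squares.**  If `f = ε Σ_{α ∈ S} X^{2α} + v + u` where `v` is a sum
of squares (the numerical part `Σᵢ sᵢ²` after rounding the Cholesky factor), the remainder `u` is
supported in `S + S` and `|u_γ| ≤ ε/#S` for all `γ` (`ε ≥ 0`), then `f` is a sum of squares over
`K` (`hK` as above).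
[cite: MagronSafeyeldin2018, Prop. 3.4 (proof, second loop of intsos)] -/
theorem isSumSq_of_remainder_coeff_le [DecidableEq σ] (hK : ∀ c : K, 0 ≤ c → IsSumSq c)
    (S : Finset (σ →₀ ℕ)) {ε : K} (hε : 0 ≤ ε) {f v u : MvPolynomial σ K} (hv : IsSumSq v)
    (hf : f = C ε * (∑ α ∈ S, monomial (2 • α) (1 : K)) + v + u) (hsupp : u.support ⊆ S + S)
    (hcoeff : ∀ γ ∈ u.support, |u.coeff γ| ≤ ε / S.card) : IsSumSq f := by
  rw [hf, add_right_comm]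
  exact (isSumSq_perturbation_add_of_coeff_le hK S hε u hsupp hcoeff).add hv

/-- The same with the `ℓ¹` test `Σ_γ |u_γ| ≤ ε` on the remainder.
[cite: MagronSafeyeldin2018, Prop. 3.4 (proof, second loop of intsos)] -/
theorem isSumSq_of_remainder_sum_abs_le [DecidableEq σ] (hK : ∀ c : K, 0 ≤ c → IsSumSq c)
    (S : Finset (σ →₀ ℕ)) {ε : K} {f v u : MvPolynomial σ K} (hv : IsSumSq v)
    (hf : f = C ε * (∑ α ∈ S, monomial (2 • α) (1 : K)) + v + u) (hsupp : u.support ⊆ S + S)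
    (hsum : ∑ γ ∈ u.support, |u.coeff γ| ≤ ε) : IsSumSq f := by
  rw [hf, add_right_comm]
  exact (isSumSq_perturbation_add_of_sum_abs_le hK S u hsupp hsum).add hv

/-- Over `ℝ`: `f = ε t + Σᵢ sᵢ² + u` with `spt u ⊆ S + S`, `|u_γ| ≤ ε/#S` ⇒ `f` is a sum of squares
in `ℝ[X]`.
[cite: MagronSafeyeldin2018, Prop. 3.4 (proof, second loop of intsos)] -/
theorem isSumSq_of_remainder_coeff_le_real [DecidableEq σ] (S : Finset (σ →₀ ℕ)) {ε : ℝ}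
    (hε : 0 ≤ ε) {f v u : MvPolynomial σ ℝ} (hv : IsSumSq v)
    (hf : f = C ε * (∑ α ∈ S, monomial (2 • α) (1 : ℝ)) + v + u) (hsupp : u.support ⊆ S + S)
    (hcoeff : ∀ γ ∈ u.support, |u.coeff γ| ≤ ε / S.card) : IsSumSq f :=
  isSumSq_of_remainder_coeff_le (fun _ h => real_isSumSq_of_nonneg h) S hε hv hf hsupp hcoeff

/-! ### §5. The perturbation step [MagronSafeyeldin2018, Prop. 3.1] -/

section Gram

variable {R : Type w} [CommRing R] {k : Type*} [Fintype k] [DecidableEq k]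

/-- **The Gram identity of the perturbation step**:
"`v_kᵀ G v_k − ε v_kᵀ I v_k = v_kᵀ (G − εI) v_k`", for any vector `z` of polynomials:
`gramPoly (G − ε•1) z = gramPoly G z − ε Σᵢ zᵢ²`.
[cite: MagronSafeyeldin2018, Prop. 3.1 (proof)] -/
theorem gramPoly_sub_smul_one (G : Matrix k k R) (ε : R) (z : k → MvPolynomial σ R) :
    gramPoly (G - ε • (1 : Matrix k k R)) z = gramPoly G z - C ε * ∑ i, z i * z i := by
  simp only [gramPoly, Matrix.sub_apply, Matrix.smul_apply, Matrix.one_apply, smul_eq_mul, mul_ite,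
    mul_one, mul_zero, map_sub, sub_mul, Finset.sum_sub_distrib, apply_ite C, map_zero, ite_mul,
    zero_mul, Finset.sum_ite_eq, Finset.mem_univ, if_true, Finset.mul_sum]

/-- With the monomial vector `(X^α)_{α ∈ S}`: `Σ_α (X^α)² = Σ_{α ∈ S} X^{2α} = t`, so
"`f_ε := f − ε Σ_{α ∈ P/2} X^{2α} = v_kᵀ (G − εI) v_k`" for `f = v_kᵀ G v_k`.
[cite: MagronSafeyeldin2018, Prop. 3.1 (proof)] -/
theorem gramPoly_monomialVec_sub_smul_one [DecidableEq σ] (S : Finset (σ →₀ ℕ))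
    (G : Matrix S S R) (ε : R) :
    gramPoly (G - ε • (1 : Matrix S S R)) (monomialVec S) =
      gramPoly G (monomialVec S) - C ε * ∑ α ∈ S, monomial (2 • α) (1 : R) := by
  rw [gramPoly_sub_smul_one, ← Finset.sum_coe_sort S]
  simp only [monomialVec, monomial_mul, mul_one, two_nsmul]

end Gram

/-- **Step 1 of `intsos` over `ℝ`**: if `G` is a Gram matrix of `f` on the exponent set `S` and
`G − εI ⪰ 0` (e.g. `ε ≤ λ_min(G)`), then the perturbed polynomial `f − ε Σ_{α ∈ S} X^{2α}` is a sum
of squares ("`yielding f_ε ∈ Σ̊[X]`" when `ε < λ_min(G)`).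
[cite: MagronSafeyeldin2018, Prop. 3.1 (proof)] -/
theorem isSumSq_sub_perturbation_of_posSemidef [DecidableEq σ] (S : Finset (σ →₀ ℕ))
    {G : Matrix S S ℝ} {ε : ℝ} {f : MvPolynomial σ ℝ} (hf : f = gramPoly G (monomialVec S))
    (hG : (G - ε • (1 : Matrix S S ℝ)).PosSemidef) :
    IsSumSq (f - C ε * ∑ α ∈ S, monomial (2 • α) (1 : ℝ)) := by
  rw [hf, ← gramPoly_monomialVec_sub_smul_one]
  exact isSumSq_gramPoly_of_posSemidef hG _

end Literature.Algebra.Polynomial.SosPerturbationAbsorption
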